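import Summits.QuantumAdvantage.QuantumAdvantage.Theorems.CompositeFrameBound.Negative.LoadBearing
import Summits.QuantumAdvantage.QuantumAdvantage.Theorems.SymplecticPurityGaussianDegreeBoundWords
import Summits.QuantumAdvantage.QuantumAdvantage.Theorems.SymplecticPurityGaussianDegreeBoundBessel
import Summits.QuantumAdvantage.QuantumAdvantage.Theorems.SymplecticPuritySymplecticPurityBoundPauli
import Summits.QuantumAdvantage.QuantumAdvantage.Theorems.SymplecticPurityCubeGraphFlat

/-!
# `CompositeFrameBound` (stmt-QuantumAdvantage-10730), line `Sketch` — stub `stub_lowAlg`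

`stub_lowAlg` of line Sketch of crux stmt-QuantumAdvantage-10730; assembles the GaussianDegreeBound
helper files (Words/Bessel) for ONE short word.  For the frame `χ = U U₁ ĝ` (Clifford `U₁`, then a
fermionic Gaussian `U`, on the `n + n`-qubit cube state `ĝ`) and a non-identity Pauli string `S`
that is a unit phase times a word of `L` Jordan–Wigner Majoranas,
`|⟨χ|S|χ⟩|² ≤ 4·2⁻ⁿ · Σ_{k=1}^{L} C(2(n+n), k)`:

* (a) `⟨χ|S|χ⟩ = ⟨φ| U†SU |φ⟩` with `φ = U₁ ĝ` (`exp_conj_eq`);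
* (b)+(c) `U†SU` lies in the span of the words of length `L` (`star_mul_word_mul_mem_span`), and
  every word is a unit phase times the Pauli string `σ_{G T}` of a SET `T` of `≤ L` modes
  (`exists_word_labelling`: `word_eq_smul_pauliString` for the explicit bit encoding of the letters,
  `exists_finset_sum_eq_list_sum` in characteristic two), so `U†SU ∈ span {σ_{G T} : |T| ≤ L}`
  (`conj_word_mem_span`);
* (d) `U†SU` is traceless, so the identity string may be erased from the family
  (`mem_span_erase_of_trace_eq_zero`);
* (e) Bessel in Hilbert–Schmidt coordinates (`sum_norm_sq_le_of_mem_span`, `inner_pauliString`):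
  `|⟨φ|U†SU|φ⟩|² ≤ Σ_{Q} |⟨φ|σ_Q|φ⟩|²` over that family (`norm_sq_exp_le_sum`);
* (f) each non-identity `|⟨φ|σ_Q|φ⟩|² ≤ 4·2⁻ⁿ`: the label map of the Clifford `U₁` is a bijection
  fixing `I` (`clifford_bijective`, `clifford_map_I`, `norm_exp_clifford`) and `ĝ = g/√2ⁿ` with
  `|⟨g|σ_T|g⟩| ≤ 2√2ⁿ` (`CubeGraphFlat_proof`) (`norm_exp_ghat_le`, `norm_sq_exp_clifford_ghat_le`);
* (g) the family has at most `Σ_{k=1}^{L} C(2(n+n), k)` members (`card_image_erase_le`).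
-/

set_option linter.dupNamespace false -- D-0017: single-problem summit ⇒ `QuantumAdvantage.QuantumAdvantage` by design

noncomputable section

namespace Summit.QuantumAdvantage.QuantumAdvantage.Theorems.SymplecticPurity.CompositeFrameBound

open Literature.Computability.Cryptography Literature.Computability.QuantumComplexity Matrix Finset
open scoped InnerProductSpace
open Summit.QuantumAdvantage.QuantumAdvantage.Theorems.CompositeFrameBound.Negative
open Summit.QuantumAdvantage.QuantumAdvantage.Theorems.SymplecticPurity

/-! ### (a) Moving the Gaussian layer onto the observable -/

/-- **(a)** `⟨Uφ| M |Uφ⟩ = ⟨φ| U† M U |φ⟩` (here `U† = star U`; no unitarity needed). -/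
theorem exp_conj_eq {N : ℕ} (U M : Matrix (QReg N) (QReg N) ℂ) (φ : QReg N → ℂ) :
    star (U *ᵥ φ) ⬝ᵥ (M *ᵥ (U *ᵥ φ)) = star φ ⬝ᵥ ((star U * M * U) *ᵥ φ) := by
  rw [Matrix.star_mulVec, ← Matrix.dotProduct_mulVec, Matrix.mulVec_mulVec, Matrix.mulVec_mulVec,
    ← Matrix.star_eq_conjTranspose]

/-! ### (c) Majorana words are phased Pauli strings of small mode sets -/

/-- **(c)** There is a labelling `G` of the sets of Majorana modes by Pauli strings, with
`G ∅ = I`, such that every Majorana word `c_{q₁} ⋯ c_{q_m}` is a unit phase times `σ_{G T}` for a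
set `T` of at most `m` modes (the modes of odd multiplicity): `word_eq_smul_pauliString` for the
explicit bit encoding `I ↦ 00, X ↦ 10, Z ↦ 01, Y ↦ 11` of the Pauli letters (a group isomorphism
modulo phases), and `exists_finset_sum_eq_list_sum` in characteristic two. -/
theorem exists_word_labelling (N : ℕ) :
    ∃ G : Finset (Fin N × Bool) → (Fin N → Pauli), G ∅ = (fun _ => Pauli.I) ∧
      ∀ w : List (Fin N × Bool), ∃ (T : Finset (Fin N × Bool)) (c : ℂ),
        T.card ≤ w.length ∧ ‖c‖ = 1 ∧
          (w.map fun q => majorana N q.1 q.2).prod = c • pauliString (G T) := by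
  -- the bit encoding of the letters and its inverse
  obtain ⟨β, π, hπβ, hβπ, hmul, hI⟩ : ∃ (β : Pauli → ZMod 2 × ZMod 2) (π : ZMod 2 × ZMod 2 → Pauli),
      (∀ P, π (β P) = P) ∧ (∀ v, β (π v) = v) ∧
        (∀ P Q : Pauli, β (P.letterMul Q) = β P + β Q) ∧ β Pauli.I = 0 :=
    ⟨fun P => match P with
      | Pauli.I => (0, 0) | Pauli.X => (1, 0) | Pauli.Z => (0, 1) | Pauli.Y => (1, 1),
     fun v => if v = (0, 0) then Pauli.I else if v = (1, 0) then Pauli.X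
      else if v = (0, 1) then Pauli.Z else Pauli.Y,
     by decide, by decide, by decide, by decide⟩
  have h2 : ∀ x : Fin N → ZMod 2 × ZMod 2, x + x = 0 := by
    have hv : ∀ v : ZMod 2 × ZMod 2, v + v = 0 := by decide
    intro x
    funext i
    exact hv (x i)
  refine ⟨fun T i => π (∑ q ∈ T, β (majoranaWord N q.1 q.2 i)), ?_, fun w => ?_⟩
  · funext i
    show π (∑ q ∈ (∅ : Finset (Fin N × Bool)), β (majoranaWord N q.1 q.2 i)) = Pauli.I
    rw [Finset.sum_empty, ← hI, hπβ]
  · obtain ⟨c, hc, hw⟩ := word_eq_smul_pauliString β π hπβ hβπ hmul hI w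
    obtain ⟨T, hT, hsum⟩ := exists_finset_sum_eq_list_sum h2 w
    refine ⟨T, c, hT, hc, ?_⟩
    rw [hw, hsum]
    simp only [Finset.sum_apply]

/-! ### (b) The dressed word lies in the span of the strings of small mode sets -/

/-- **(b)+(c)** For a Gaussian unitary `U` and a word `w` of length `L`, `U† (c_{q₁} ⋯ c_{q_L}) U`
lies in the span of the Pauli strings `σ_{G T}`, `|T| ≤ L` (`star_mul_word_mul_mem_span`: it is in
the span of the words of length `L`, each of which is a phased `σ_{G T}`). -/
theorem conj_word_mem_span {N : ℕ} {U : Matrix (QReg N) (QReg N) ℂ}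
    (hU : U ∈ Matrix.unitaryGroup (QReg N) ℂ) (hG : IsGaussianU U)
    {G : Finset (Fin N × Bool) → (Fin N → Pauli)}
    (hGw : ∀ w : List (Fin N × Bool), ∃ (T : Finset (Fin N × Bool)) (c : ℂ),
      T.card ≤ w.length ∧ ‖c‖ = 1 ∧
        (w.map fun q => majorana N q.1 q.2).prod = c • pauliString (G T))
    (l : List (Fin N × Bool)) :
    star U * (l.map fun q => majorana N q.1 q.2).prod * U ∈
      Submodule.span ℂ (pauliString ''
        ↑((Finset.univ.filter fun T : Finset (Fin N × Bool) => T.card ≤ l.length).image G)) := by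
  obtain ⟨R, hR, hRG⟩ := hG
  have hsub : {M : Matrix (QReg N) (QReg N) ℂ | ∃ w' : List (Fin N × Bool), w'.length = l.length ∧
      (w'.map fun q => majorana N q.1 q.2).prod = M} ⊆
      (Submodule.span ℂ (pauliString '' (↑((Finset.univ.filter fun T : Finset (Fin N × Bool) =>
        T.card ≤ l.length).image G) : Set (Fin N → Pauli))) : Set (Matrix (QReg N) (QReg N) ℂ)) := by
    rintro _ ⟨w', hw', rfl⟩
    obtain ⟨T, c, hT, -, hw⟩ := hGw w'
    rw [hw]
    refine Submodule.smul_mem _ _ (Submodule.subset_span ⟨G T, ?_, rfl⟩)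
    exact Finset.mem_coe.2 (Finset.mem_image.2
      ⟨T, Finset.mem_filter.2 ⟨Finset.mem_univ _, hw' ▸ hT⟩, rfl⟩)
  exact SetLike.le_def.1 (Submodule.span_le.2 hsub)
    (star_mul_word_mul_mem_span hU (star_mul_majorana_mul hU hR hRG) l)

/-! ### (d) Dropping the identity string -/

/-- **(d)** A traceless matrix in the span of a family of Pauli strings lies in the span of the
non-identity members of the family (subtract the component along `σ_I = 1`: the other strings are
traceless). -/
theorem mem_span_erase_of_trace_eq_zero {N : ℕ} (𝒬 : Finset (Fin N → Pauli))
    {M : Matrix (QReg N) (QReg N) ℂ} (hM : M ∈ Submodule.span ℂ (pauliString '' ↑𝒬))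
    (htr : M.trace = 0) :
    M ∈ Submodule.span ℂ (pauliString '' ↑(𝒬.erase fun _ => Pauli.I)) := by
  have hd0 : (Fintype.card (QReg N) : ℂ) ≠ 0 := Nat.cast_ne_zero.2 Fintype.card_ne_zero
  have key : ∀ X ∈ Submodule.span ℂ (pauliString '' ↑𝒬),
      X - X.trace • ((Fintype.card (QReg N) : ℂ)⁻¹ • (1 : Matrix (QReg N) (QReg N) ℂ)) ∈
        Submodule.span ℂ (pauliString '' ↑(𝒬.erase fun _ => Pauli.I)) := by
    intro X hX
    induction hX using Submodule.span_induction with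
    | mem x hx =>
      obtain ⟨Q, hQ, rfl⟩ := hx
      by_cases hQI : Q = fun _ => Pauli.I
      · subst hQI
        rw [pauliString_const_I, Matrix.trace_one, smul_smul, mul_inv_cancel₀ hd0, one_smul,
          sub_self]
        exact Submodule.zero_mem _
      · have h0 : (pauliString Q).trace = 0 := by
          have h := trace_pauliString_mul_pauliString Q (fun _ => Pauli.I)
          rwa [pauliString_const_I, Matrix.mul_one, if_neg hQI] at h
        rw [h0, zero_smul, sub_zero]
        exact Submodule.subset_span ⟨Q, Finset.mem_coe.2 (Finset.mem_erase.2 ⟨hQI, hQ⟩), rfl⟩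
    | zero =>
      rw [Matrix.trace_zero, zero_smul, sub_zero]
      exact Submodule.zero_mem _
    | add x y _ _ hx hy =>
      rw [Matrix.trace_add, add_smul, add_sub_add_comm]
      exact Submodule.add_mem _ hx hy
    | smul a x _ hx =>
      rw [Matrix.trace_smul, smul_eq_mul, ← smul_smul, ← smul_sub]
      exact Submodule.smul_mem _ _ hx
  have h := key M hM
  rwa [htr, zero_smul, sub_zero] at h

/-! ### (e) Bessel on a family of Pauli strings -/

/-- **(e)** If `M` with `Tr(Mᴴ M) = 2ᴺ` lies in the span of the strings `σ_Q`, `Q ∈ 𝒬`, then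
`|⟨φ|M|φ⟩|² ≤ Σ_{Q ∈ 𝒬} |⟨φ|σ_Q|φ⟩|²` for every vector `φ`: `sum_norm_sq_le_of_mem_span` in
Hilbert–Schmidt coordinates (`⟪σ_Q, σ_{Q'}⟫ = 2ᴺ δ`, `inner_pauliString`) for the linear functional
`A ↦ ⟨φ|A|φ⟩`. -/
theorem norm_sq_exp_le_sum {N : ℕ} (φ : QReg N → ℂ) (𝒬 : Finset (Fin N → Pauli))
    {M : Matrix (QReg N) (QReg N) ℂ} (hM : M ∈ Submodule.span ℂ (pauliString '' ↑𝒬))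
    (hMM : (Mᴴ * M).trace = (2 : ℂ) ^ N) :
    ‖star φ ⬝ᵥ (M *ᵥ φ)‖ ^ 2 ≤ ∑ Q ∈ 𝒬, ‖star φ ⬝ᵥ (pauliString Q *ᵥ φ)‖ ^ 2 := by
  -- Hilbert–Schmidt coordinates (a linear map) and the expectation functional on them
  obtain ⟨Φ, hΦ⟩ : ∃ Φ : Matrix (QReg N) (QReg N) ℂ →ₗ[ℂ] EuclideanSpace ℂ (QReg N × QReg N),
      ∀ A p, Φ A p = A p.1 p.2 :=
    ⟨{ toFun := fun A => WithLp.toLp 2 fun p => A p.1 p.2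
       map_add' := fun _ _ => rfl
       map_smul' := fun _ _ => rfl }, fun _ _ => rfl⟩
  obtain ⟨f, hf⟩ : ∃ f : EuclideanSpace ℂ (QReg N × QReg N) →ₗ[ℂ] ℂ,
      ∀ A, f (Φ A) = star φ ⬝ᵥ (A *ᵥ φ) := by
    refine ⟨{ toFun := fun u => ∑ p, star (φ p.1) * φ p.2 * u p
              map_add' := fun u v => ?_
              map_smul' := fun a u => ?_ }, fun A => ?_⟩
    · simp only [PiLp.add_apply, mul_add, Finset.sum_add_distrib]
    · simp only [PiLp.smul_apply, smul_eq_mul, RingHom.id_apply, Finset.mul_sum]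
      exact Finset.sum_congr rfl fun p _ => by ring
    · simp only [LinearMap.coe_mk, AddHom.coe_mk, hΦ, dotProduct, Matrix.mulVec, Pi.star_apply,
        Finset.mul_sum, Fintype.sum_prod_type]
      exact Finset.sum_congr rfl fun x _ => Finset.sum_congr rfl fun y _ => by ring
  have hpos : (0 : ℝ) < 2 ^ N := by positivity
  have hcast : (((2 : ℝ) ^ N : ℝ) : ℂ) = (2 : ℂ) ^ N := by norm_num
  have hu : ∀ i j : Unit, ⟪Φ M, Φ M⟫_ℂ = if i = j then (((2 : ℝ) ^ N : ℝ) : ℂ) else 0 := by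
    intro i j
    rw [if_pos (Subsingleton.elim i j), inner_eq_trace_of_apply Φ hΦ, hMM, hcast]
  have hb : ∀ k k' : 𝒬, ⟪Φ (pauliString (k : Fin N → Pauli)), Φ (pauliString (k' : Fin N → Pauli))⟫_ℂ =
      if k = k' then (((2 : ℝ) ^ N : ℝ) : ℂ) else 0 := by
    intro k k'
    rw [inner_pauliString Φ hΦ, hcast]
    by_cases hkk : k = k'
    · rw [if_pos hkk, if_pos (congrArg Subtype.val hkk)]
    · rw [if_neg hkk, if_neg fun h => hkk (Subtype.ext h)]
  have hmem : Φ M ∈ Submodule.span ℂ (Set.range fun k : 𝒬 => Φ (pauliString (k : Fin N → Pauli))) := by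
    have h := Submodule.apply_mem_span_image_of_mem_span Φ hM
    rwa [Set.image_image, Set.image_eq_range] at h
  have hB := sum_norm_sq_le_of_mem_span hpos (fun _ : Unit => Φ M)
    (fun k : 𝒬 => Φ (pauliString (k : Fin N → Pauli))) hu hb (fun _ => hmem) f
  rw [Fintype.sum_unique, ← Finset.sum_subtype 𝒬 (fun _ => Iff.rfl)
    (fun Q => ‖f (Φ (pauliString Q))‖ ^ 2)] at hB
  simpa only [hf] using hB

/-! ### (f) Non-identity strings are small on `U₁ ĝ` -/

/-- **(f₀) Flatness of the normalised cube state**: `|⟨ĝ| σ_T |ĝ⟩| ≤ 2·(√2ⁿ)⁻¹` for `T ≠ I`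
(`ĝ = (√2ⁿ)⁻¹ • g` for the graph vector `g` of `CubeGraphFlat`, `|⟨g| σ_T |g⟩| ≤ 2 √2ⁿ`). -/
theorem norm_exp_ghat_le (n : ℕ) (K : Type) [Field K] [Fintype K] (hK : Fintype.card K = 2 ^ n)
    (e : K ≃+ (Fin n → ZMod 2)) (T : Fin (n + n) → Pauli) (hT : T ≠ fun _ => Pauli.I) :
    ‖star (ghat n K e) ⬝ᵥ (pauliString T *ᵥ ghat n K e)‖ ≤ 2 * (Real.sqrt 2 ^ n)⁻¹ := by
  obtain ⟨g, hg, hflat⟩ : ∃ g : QReg (n + n) → ℂ,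
      ghat n K e = ((Real.sqrt 2 ^ n)⁻¹ : ℂ) • g ∧
        ‖star g ⬝ᵥ (pauliString T *ᵥ g)‖ ≤ 2 * Real.sqrt 2 ^ n :=
    ⟨_, by
      funext w
      simp only [ghat, Pi.smul_apply, smul_eq_mul]
      split_ifs <;> simp,
      CubeGraphFlat_proof n K hK e T hT⟩
  have hr : (0 : ℝ) < Real.sqrt 2 ^ n := pow_pos (Real.sqrt_pos.2 two_pos) n
  have hs : ‖((Real.sqrt 2 ^ n)⁻¹ : ℂ)‖ = (Real.sqrt 2 ^ n)⁻¹ := by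
    rw [norm_inv, norm_pow, Complex.norm_real, Real.norm_of_nonneg (Real.sqrt_nonneg 2)]
  rw [hg, star_smul, Matrix.mulVec_smul, smul_dotProduct, dotProduct_smul, norm_smul, norm_smul,
    norm_star, hs]
  calc (Real.sqrt 2 ^ n)⁻¹ * ((Real.sqrt 2 ^ n)⁻¹ * ‖star g ⬝ᵥ (pauliString T *ᵥ g)‖)
      ≤ (Real.sqrt 2 ^ n)⁻¹ * ((Real.sqrt 2 ^ n)⁻¹ * (2 * Real.sqrt 2 ^ n)) :=
        mul_le_mul_of_nonneg_left (mul_le_mul_of_nonneg_left hflat (inv_nonneg.2 hr.le))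
          (inv_nonneg.2 hr.le)
    _ = 2 * (Real.sqrt 2 ^ n)⁻¹ * ((Real.sqrt 2 ^ n)⁻¹ * Real.sqrt 2 ^ n) := by ring
    _ = 2 * (Real.sqrt 2 ^ n)⁻¹ := by rw [inv_mul_cancel₀ hr.ne', mul_one]

-- adapted from Summits/QuantumAdvantage/QuantumAdvantage/Cruxes/CompositeFrameBound/Disproof.lean §4
/-- **(f)** For a Clifford unitary `U₁` and `Q ≠ I`, `|⟨U₁ĝ| σ_Q |U₁ĝ⟩|² ≤ 4·2⁻ⁿ`: the label map
`f` of `U₁` is a bijection of the strings fixing `I` (`clifford_bijective`, `clifford_map_I`), so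
`Q = f T` with `T ≠ I`, `|⟨U₁ĝ| σ_{f T} |U₁ĝ⟩| = |⟨ĝ| σ_T |ĝ⟩|` (`norm_exp_clifford`), and (f₀). -/
theorem norm_sq_exp_clifford_ghat_le (n : ℕ) (K : Type) [Field K] [Fintype K]
    (hK : Fintype.card K = 2 ^ n) (e : K ≃+ (Fin n → ZMod 2))
    {U₁ : Matrix (QReg (n + n)) (QReg (n + n)) ℂ} (hu : U₁ ∈ Matrix.unitaryGroup (QReg (n + n)) ℂ)
    (hc : IsCliffordU U₁) (Q : Fin (n + n) → Pauli) (hQ : Q ≠ fun _ => Pauli.I) :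
    ‖star (U₁ *ᵥ ghat n K e) ⬝ᵥ (pauliString Q *ᵥ (U₁ *ᵥ ghat n K e))‖ ^ 2 ≤
      4 * ((2 : ℝ) ^ n)⁻¹ := by
  choose f c hcf hf using hc
  have hf' : ∀ S, ‖c S‖ = 1 ∧ U₁ * pauliString S * U₁ᴴ = c S • pauliString (f S) :=
    fun S => ⟨hcf S, by rw [← Matrix.star_eq_conjTranspose]; exact hf S⟩
  have hU : U₁ᴴ * U₁ = 1 := by
    rw [← Matrix.star_eq_conjTranspose]; exact Matrix.mem_unitaryGroup_iff'.1 hu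
  have hU' : U₁ * U₁ᴴ = 1 := by
    rw [← Matrix.star_eq_conjTranspose]; exact Matrix.mem_unitaryGroup_iff.1 hu
  obtain ⟨T, rfl⟩ := (clifford_bijective hU hf').2 Q
  have hT : T ≠ fun _ => Pauli.I := by
    rintro rfl
    exact hQ (clifford_map_I hU' hf')
  rw [norm_exp_clifford hU hf' (ghat n K e) T]
  have hr2 : (Real.sqrt 2 ^ n) ^ 2 = 2 ^ n := by
    rw [← pow_mul, mul_comm n 2, pow_mul, Real.sq_sqrt (by norm_num : (0 : ℝ) ≤ 2)]
  calc ‖star (ghat n K e) ⬝ᵥ (pauliString T *ᵥ ghat n K e)‖ ^ 2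
      ≤ (2 * (Real.sqrt 2 ^ n)⁻¹) ^ 2 :=
        pow_le_pow_left₀ (norm_nonneg _) (norm_exp_ghat_le n K hK e T hT) 2
    _ = 4 * ((2 : ℝ) ^ n)⁻¹ := by rw [mul_pow, inv_pow, hr2]; norm_num

/-! ### Assembly -/

/-- **`stub_lowAlg`** (line `Sketch` of crux stmt-QuantumAdvantage-10730; the algebraic half of
"short words are peak-free").  For every frame `χ = U U₁ ĝ` (Clifford `U₁`, Gaussian `U`) and every
NON-IDENTITY Pauli string `S` that is a unit phase times a word of `L` Jordan–Wigner Majoranas,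
`|⟨χ|S|χ⟩|² ≤ 4·2⁻ⁿ · Σ_{k=1}^{L} C(2(n+n), k)`: steps (a)–(g) of the module docstring. -/
theorem stub_lowAlg :
    ∀ (n : ℕ) (K : Type) [Field K] [Fintype K], Fintype.card K = 2 ^ n →
      ∀ e : K ≃+ (Fin n → ZMod 2), ∀ U₁ U : Matrix (QReg (n + n)) (QReg (n + n)) ℂ,
      U₁ ∈ Matrix.unitaryGroup (QReg (n + n)) ℂ → IsCliffordU U₁ →
      U ∈ Matrix.unitaryGroup (QReg (n + n)) ℂ → IsGaussianU U →
      ∀ S : Fin (n + n) → Pauli, S ≠ (fun _ => Pauli.I) →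
      ∀ (l : List (Fin (n + n) × Bool)) (a : ℂ), ‖a‖ = 1 →
        pauliString S = a • (l.map fun p => majorana (n + n) p.1 p.2).prod →
        ‖star (U *ᵥ (U₁ *ᵥ ghat n K e)) ⬝ᵥ (pauliString S *ᵥ (U *ᵥ (U₁ *ᵥ ghat n K e)))‖ ^ 2 ≤
          4 * ((2 : ℝ) ^ n)⁻¹ * ∑ k ∈ Finset.Icc 1 l.length, ((2 * (n + n)).choose k : ℝ) := by
  intro n K _ _ hK e U₁ U hu₁ hc₁ hu hg S hS l a _ hSl
  obtain ⟨G, hG0, hGw⟩ := exists_word_labelling (n + n)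
  -- (a)
  rw [exp_conj_eq]
  -- (b)+(c): the dressed string is in the span of the strings of mode sets of size `≤ L`
  have hspan' : star U * pauliString S * U ∈ Submodule.span ℂ (pauliString ''
      ↑((Finset.univ.filter fun T : Finset (Fin (n + n) × Bool) => T.card ≤ l.length).image G)) := by
    rw [hSl, Matrix.mul_smul, Matrix.smul_mul]
    exact Submodule.smul_mem _ _ (conj_word_mem_span hu hg hGw l)
  -- (d): it is traceless, so the identity string is not needed
  have htr : (star U * pauliString S * U).trace = 0 := by
    rw [Matrix.trace_mul_cycle, Unitary.mul_star_self_of_mem hu, Matrix.one_mul]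
    have h := trace_pauliString_mul_pauliString S (fun _ => Pauli.I)
    rwa [pauliString_const_I, Matrix.mul_one, if_neg hS] at h
  have hspan := mem_span_erase_of_trace_eq_zero _ hspan' htr
  -- (e): Bessel (`U†SU` is a unitary involution, `Tr((U†SU)ᴴ U†SU) = 2^{n+n}`)
  have hMM : ((star U * pauliString S * U)ᴴ * (star U * pauliString S * U)).trace =
      (2 : ℂ) ^ (n + n) := by
    have h1 : (star U * pauliString S * U)ᴴ = star U * pauliString S * U := by
      rw [Matrix.conjTranspose_mul, Matrix.conjTranspose_mul, conjTranspose_pauliString,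
        ← Matrix.star_eq_conjTranspose, ← Matrix.star_eq_conjTranspose, star_star, Matrix.mul_assoc]
    have h2 : star U * pauliString S * U * (star U * pauliString S * U) = 1 := by
      calc star U * pauliString S * U * (star U * pauliString S * U)
          = star U * pauliString S * (U * star U) * pauliString S * U := by
            simp only [Matrix.mul_assoc]
        _ = 1 := by
            rw [Unitary.mul_star_self_of_mem hu, Matrix.mul_one, Matrix.mul_assoc (star U),
              pauliString_mul_self, Matrix.mul_one, Unitary.star_mul_self_of_mem hu]
    rw [h1, h2, Matrix.trace_one, Fintype.card_fun, Fintype.card_bool, Fintype.card_fin]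
    simp
  refine (norm_sq_exp_le_sum (U₁ *ᵥ ghat n K e) _ hspan hMM).trans ?_
  -- (f): every member of the family is small on `U₁ ĝ`
  refine (Finset.sum_le_sum fun Q hQ => norm_sq_exp_clifford_ghat_le n K hK e hu₁ hc₁ Q
    (Finset.mem_erase.1 hQ).1).trans ?_
  -- (g): counting the family
  have hcard := card_image_erase_le (n + n) l.length G
  rw [hG0] at hcard
  have hcard' : ((((Finset.univ.filter fun T : Finset (Fin (n + n) × Bool) => T.card ≤ l.length).image
      G).erase fun _ => Pauli.I).card : ℝ) ≤ ∑ k ∈ Finset.Icc 1 l.length, ((2 * (n + n)).choose k : ℝ) := by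
    exact_mod_cast hcard
  rw [Finset.sum_const, nsmul_eq_mul]
  calc _ ≤ (∑ k ∈ Finset.Icc 1 l.length, ((2 * (n + n)).choose k : ℝ)) * (4 * ((2 : ℝ) ^ n)⁻¹) :=
        mul_le_mul_of_nonneg_right hcard' (by positivity)
    _ = 4 * ((2 : ℝ) ^ n)⁻¹ * ∑ k ∈ Finset.Icc 1 l.length, ((2 * (n + n)).choose k : ℝ) := by ring

end Summit.QuantumAdvantage.QuantumAdvantage.Theorems.SymplecticPurity.CompositeFrameBound

end
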